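import Literature.NumberTheory.Automorphic.RankinSelbergTwistedUnfoldingGroupSide
import Literature.NumberTheory.Automorphic.GodementJacquetBruhatWeight
import Literature.NumberTheory.Automorphic.JPSSGlobalIntegralQuotientUnfolding
import Literature.NumberTheory.GaloisRepresentations.HeckeCharacter
import HarnessLib

/-!
# The fibre side of the twisted Rankin–Selberg unfolding: the fibre integral of the twisted test
# function is the `η`-twisted idele-class Eisenstein integral (Bochner form of
# `lintegral_quotientSubgroup_testFun_eq`)

Topic `NumberTheory/Automorphic`; namespace `Literature.NumberTheory.Automorphic`. Proof file
(theorems only). Companion of `RankinSelbergTwistedUnfoldingGroupSide` in the inline decomposition of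
the named fact `MoeglinWaldspurger1989_partialPairL_entire_of_ne_conj` (Mœglin–Waldspurger (1989),
Appendice, Cor. (i)(b)) for the pairs whose central characters do not cancel: Step 1 of the first
unfolding `∫_X φ φ' E_X(·, Φ; s, η) dμ = C ∫_{GL_n(𝔸_K)} W β φ φ' dν` of the Rankin–Selberg integral
against the **twisted** mirabolic Eisenstein series (Jacquet–Shalika (1981), §4; Cogdell (2004), §2.3),
in Bochner form. For the twisted test function

  `f_η(y) = (∫_{𝕀_K¹} W(sc(b) y⁻¹) η(b) β¹(b) dβ) β(y⁻¹)`

(`W : GL_n(𝔸_K) → ℂ` Borel and `GL_n(K)`-invariant, `η` a unitary Hecke character trivial on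
`A_G = ρ(ℝ_{>0})`, `β¹` a `Kˣ`-covering weight on `𝕀_K¹`, `β` a `GL_n(K)`-covering weight) the fibre
integral over `H = A_G GL_n(K)` is

  `∫_H f_η(g h) dρ_H(h) = κ κ₁⁻¹ ∫_𝓕 W(sc(a) g⁻¹) η(a) dν_I(a)`

(`integral_quotientSubgroup_testFunTwisted_eq`, **main**) — `|det g|^{-s}` times the twisted Eisenstein
series at `g⁻¹` when `W = W_s` is the theta weight —, as soon as the majorant idele-class integral
`∫_𝓕 |W(sc(a) g⁻¹)| dν_I` is finite; and the fibre function `h ↦ f_η(g h)` is `ρ_H`-integrable. The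
computation is that of `lintegral_quotientSubgroup_testFun_eq` (the sum over `GL_n(K)` collapses `β`,
the integrals over `A_G` and `𝕀_K¹` recombine into `𝔸_Kˣ`, the sum over `Kˣ` folds `𝔸_Kˣ` onto `𝓕`
collapsing `β¹`), the character riding along because `η` is trivial on `A_G` and on `Kˣ`; every exchange
of sum and integral is justified by the corresponding `[0, ∞]` identity for `|W|`.

Also proved here, as identities of MEASURES so that the `[0, ∞]` and the Bochner forms share their
constants: `exists_map_ideleSplitEquiv_eq_smul_prod` (`𝕀_K ≅ 𝕀_K¹ × M` carries `ν_I` to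
`κ₁ (β ⊗ α)`; Cassels–Fröhlich XV §4.3, Weil IV §4) with `lintegral_ideleGroup_eq_of_map_eq`,
`integral_ideleGroup_eq_of_map_eq` (the fibre product structure `ρ_H = κ (α ⊗ count)` and its `[0, ∞]`
and Bochner forms being `GLnZetaKernel.exists_map_quotientSubgroupEquiv_eq_smul_prod`,
`GodementJacquetBruhatWeight.lintegral_quotientSubgroup_eq_mul_lintegral_tsum`,
`GLnZetaKernel.integral_quotientSubgroup_eq_smul_integral_tsum`).

## References

* H. Jacquet, J. A. Shalika, *On Euler products and the classification of automorphic
  representations I*, Amer. J. Math. 103 (1981), §4 [JacquetShalikaAJM1981].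
* J. W. Cogdell, *Analytic theory of L-functions for GL_n*, in *An Introduction to the Langlands
  Program* (2004), §2.3 [CogdellAnalyticTheory2004].
* J. W. S. Cassels, A. Fröhlich (eds.), *Algebraic Number Theory* (1967), Ch. XV (Tate), §4.3
  [CasselsFrohlichANT1967].
-/

noncomputable section

open MeasureTheory Measure Set Filter Topology IsDedekindDomain NumberField Function
open Literature.MeasureTheory.Group
open scoped ENNReal NNReal Pointwise

namespace Literature.NumberTheory.Automorphic

open Literature.NumberTheory.GaloisRepresentations (ideleGroup principalIdeles HeckeCharacter)

-- the quotient carries the tree's Borel σ-algebra, not Mathlib's quotient σ-algebra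
attribute [-instance] Quotient.instMeasurableSpace QuotientGroup.measurableSpace

/-! ### `𝕀_K ≅ 𝕀_K¹ × M` as an identity of measures -/

section Splitting

variable (K : Type) [Field K] [NumberField K]
variable [MeasurableSpace (ideleGroup K)] [BorelSpace (ideleGroup K)]

/-- **Weil's splitting as an identity of measures**: for Haar measures `ν` on `𝕀_K`, `β` on `𝕀_K¹` and
`α` on `M = ρ(ℝ_{>0})` there is `κ₁ > 0` with `Measure.map (ideleSplitEquiv K) ν = κ₁ • (β ⊗ α)` (Haar
uniqueness on the second countable locally compact group `𝕀_K¹ × M`; the measure form of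
`exists_lintegral_ideleGroup_eq_mul_lintegral_lintegral`). [cite: CasselsFrohlichANT1967, Ch. XV §4.3] -/
theorem exists_map_ideleSplitEquiv_eq_smul_prod
    (ν : Measure (ideleGroup K)) [ν.IsHaarMeasure]
    (β : Measure ↥(normOneIdeles K)) [β.IsHaarMeasure]
    (α : Measure ↥(posRealIdeles K)) [α.IsHaarMeasure] :
    ∃ κ₁ : ℝ≥0, 0 < κ₁ ∧ Measure.map (ideleSplitEquiv K) ν = κ₁ • β.prod α := by
  haveI := locallyCompactSpace_ideleGroup K
  haveI := secondCountableTopology_ideleGroup K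
  haveI := t2Space_ideleGroup K
  haveI := locallyCompactSpace_normOneIdeles K
  haveI := locallyCompactSpace_posRealIdeles K
  haveI : BorelSpace ↥(normOneIdeles K) := Subtype.borelSpace _
  haveI : BorelSpace ↥(posRealIdeles K) := Subtype.borelSpace _
  haveI : SecondCountableTopology ↥(normOneIdeles K) := TopologicalSpace.Subtype.secondCountableTopology _
  haveI : SecondCountableTopology ↥(posRealIdeles K) := TopologicalSpace.Subtype.secondCountableTopology _
  haveI : BorelSpace (↥(normOneIdeles K) × ↥(posRealIdeles K)) := Prod.borelSpace
  set e := ideleSplitEquiv K with he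
  set π : Measure (↥(normOneIdeles K) × ↥(posRealIdeles K)) := β.prod α with hπ
  haveI : π.IsHaarMeasure := by rw [hπ]; infer_instance
  haveI : (Measure.map e ν).IsHaarMeasure := e.toMulEquiv.isHaarMeasure_map ν e.continuous e.symm.continuous
  exact ⟨(Measure.map e ν).haarScalarFactor π, haarScalarFactor_pos_of_isHaarMeasure _ π,
    isMulLeftInvariant_eq_smul _ π⟩

variable {K}

/-- The `[0, ∞]` splitting `∫_{𝕀_K} F dν = κ₁ ∫_M ∫_{𝕀_K¹} F(b t) dβ(b) dα(t)` for Borel `F ≥ 0`, from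
the measure identity. [cite: CasselsFrohlichANT1967, Ch. XV §4.3] -/
theorem lintegral_ideleGroup_eq_of_map_eq
    {ν : Measure (ideleGroup K)} {β : Measure ↥(normOneIdeles K)} [SFinite β]
    {α : Measure ↥(posRealIdeles K)} [SFinite α] {κ₁ : ℝ≥0}
    (h : Measure.map (ideleSplitEquiv K) ν = κ₁ • β.prod α)
    {F : ideleGroup K → ℝ≥0∞} (hF : Measurable F) :
    ∫⁻ x, F x ∂ν = κ₁ * ∫⁻ t, ∫⁻ b, F ((b : ideleGroup K) * (t : ideleGroup K)) ∂β ∂α := by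
  haveI := locallyCompactSpace_ideleGroup K
  haveI := secondCountableTopology_ideleGroup K
  haveI := t2Space_ideleGroup K
  haveI := locallyCompactSpace_normOneIdeles K
  haveI := locallyCompactSpace_posRealIdeles K
  haveI : BorelSpace ↥(normOneIdeles K) := Subtype.borelSpace _
  haveI : BorelSpace ↥(posRealIdeles K) := Subtype.borelSpace _
  haveI : SecondCountableTopology ↥(normOneIdeles K) := TopologicalSpace.Subtype.secondCountableTopology _
  haveI : SecondCountableTopology ↥(posRealIdeles K) := TopologicalSpace.Subtype.secondCountableTopology _
  haveI : BorelSpace (↥(normOneIdeles K) × ↥(posRealIdeles K)) := Prod.borelSpace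
  set em : ideleGroup K ≃ᵐ ↥(normOneIdeles K) × ↥(posRealIdeles K) :=
    (ideleSplitEquiv K).toHomeomorph.toMeasurableEquiv with hem
  have hem' : (em : _ → _) = ideleSplitEquiv K := rfl
  have hG : Measurable fun p : ↥(normOneIdeles K) × ↥(posRealIdeles K) => F ((ideleSplitEquiv K).symm p) :=
    hF.comp (ideleSplitEquiv K).symm.continuous.measurable
  have h1 : ∫⁻ p, F ((ideleSplitEquiv K).symm p) ∂(Measure.map (ideleSplitEquiv K) ν) = ∫⁻ x, F x ∂ν := by
    rw [← hem', lintegral_map_equiv]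
    refine lintegral_congr fun x => ?_
    rw [hem', ContinuousMulEquiv.symm_apply_apply]
  rw [← h1, h, lintegral_smul_measure, lintegral_prod_symm _ hG.aemeasurable]
  rfl

variable {E : Type*} [NormedAddCommGroup E] [NormedSpace ℝ E]

/-- **The Bochner splitting** `∫_{𝕀_K} F dν = κ₁ • ∫_M ∫_{𝕀_K¹} F(b t) dβ(b) dα(t)` for Borel integrable
`F`, from the measure identity (transport along `ideleSplitEquiv`, Fubini), with the integrability of the
transported function. [cite: CasselsFrohlichANT1967, Ch. XV §4.3] -/
theorem integral_ideleGroup_eq_of_map_eq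
    {ν : Measure (ideleGroup K)} {β : Measure ↥(normOneIdeles K)} [SFinite β]
    {α : Measure ↥(posRealIdeles K)} [SFinite α] {κ₁ : ℝ≥0} (hκ₁ : 0 < κ₁)
    (h : Measure.map (ideleSplitEquiv K) ν = κ₁ • β.prod α)
    {F : ideleGroup K → E} (hFi : Integrable F ν) :
    Integrable (fun p : ↥(normOneIdeles K) × ↥(posRealIdeles K) =>
        F ((p.1 : ideleGroup K) * (p.2 : ideleGroup K))) (β.prod α) ∧
      ∫ x, F x ∂ν = (κ₁ : ℝ) • ∫ t, ∫ b, F ((b : ideleGroup K) * (t : ideleGroup K)) ∂β ∂α := by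
  haveI := locallyCompactSpace_ideleGroup K
  haveI := secondCountableTopology_ideleGroup K
  haveI := t2Space_ideleGroup K
  haveI := locallyCompactSpace_normOneIdeles K
  haveI := locallyCompactSpace_posRealIdeles K
  haveI : BorelSpace ↥(normOneIdeles K) := Subtype.borelSpace _
  haveI : BorelSpace ↥(posRealIdeles K) := Subtype.borelSpace _
  haveI : SecondCountableTopology ↥(normOneIdeles K) := TopologicalSpace.Subtype.secondCountableTopology _
  haveI : SecondCountableTopology ↥(posRealIdeles K) := TopologicalSpace.Subtype.secondCountableTopology _
  haveI : BorelSpace (↥(normOneIdeles K) × ↥(posRealIdeles K)) := Prod.borelSpace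
  set em : ideleGroup K ≃ᵐ ↥(normOneIdeles K) × ↥(posRealIdeles K) :=
    (ideleSplitEquiv K).toHomeomorph.toMeasurableEquiv with hem
  have hem' : (em : _ → _) = ideleSplitEquiv K := rfl
  set F' : ↥(normOneIdeles K) × ↥(posRealIdeles K) → E := fun p => F ((ideleSplitEquiv K).symm p) with hF'
  have hcomp : ∀ x, F' (em x) = F x := fun x => by
    simp only [hF', hem', ContinuousMulEquiv.symm_apply_apply]
  have hF'ν : Integrable F' (Measure.map (ideleSplitEquiv K) ν) := by
    rw [← hem', integrable_map_equiv em]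
    have : F' ∘ em = F := funext fun x => hcomp x
    rw [this]
    exact hFi
  have hint : ∫ x, F x ∂ν = ∫ p, F' p ∂(Measure.map (ideleSplitEquiv K) ν) := by
    rw [← hem', integral_map_equiv em]
    exact integral_congr_ae (Eventually.of_forall fun x => (hcomp x).symm)
  rw [h] at hF'ν
  have hκ0 : (κ₁ : ℝ≥0∞) ≠ 0 := by exact_mod_cast hκ₁.ne'
  have hF'π : Integrable F' (β.prod α) := (integrable_smul_measure hκ0 ENNReal.coe_ne_top).1 hF'ν
  refine ⟨hF'π, ?_⟩
  rw [hint, h, integral_smul_nnreal_measure, integral_prod_symm F' hF'π]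
  rfl

end Splitting

/-! ### The fibre integral of the twisted test function -/

section Fibre

variable {n : ℕ} {K : Type} [Field K] [NumberField K]

attribute [local instance] adelicBorel borelSpace_adelic locallyCompactSpace_adelic
  secondCountableTopology_gl_adelic glAdeleBorel borelSpace_glAdele

variable [MeasurableSpace (ideleGroup K)] [BorelSpace (ideleGroup K)]

omit [BorelSpace (ideleGroup K)] in
/-- The real covering sum of a `Kˣ`-covering weight on `𝕀_K¹`, read on `𝕀_K` through the retraction
`b₀ = normOneRetraction`: `Σ_{k ∈ Kˣ} β¹(k b₀(x)) = 1` in `ℝ` (term by term finite). [folklore] -/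
theorem tsum_toReal_coveringWeight_normOne
    {β₁ : ↥(normOneIdeles K) → ℝ≥0∞} (hβ₁ : IsCoveringWeight ↥((principalIdeles K).subgroupOf (normOneIdeles K)) β₁)
    (b : ↥(normOneIdeles K)) :
    ∑' k : ↥((principalIdeles K).subgroupOf (normOneIdeles K)), (β₁ (k • b)).toReal = 1 := by
  have h := hβ₁.coveringSum_eq b
  rw [coveringSum_apply] at h
  rw [← ENNReal.tsum_toReal_eq (fun k => ne_top_of_le_ne_top ENNReal.one_ne_top (hβ₁.le_one _)), h,
    ENNReal.toReal_one]

omit [MeasurableSpace (ideleGroup K)] [BorelSpace (ideleGroup K)] in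
/-- A unitary Hecke character trivial on `A_G` takes the value `1` on `M = ρ(ℝ_{>0})`. [folklore] -/
theorem heckeCharacter_apply_posRealIdeles {η : HeckeCharacter K} (hη₀ : ∀ t : ℝ≥0ˣ, η (posRealIdele K t) = 1)
    (p : ↥(posRealIdeles K)) : η (p : ideleGroup K) = 1 := by
  obtain ⟨t, ht⟩ := p.2
  rw [← ht]
  exact hη₀ t

/-- **The fibre integral of the twisted test function** (Step 1 of the twisted first unfolding; the
Bochner form of `lintegral_quotientSubgroup_testFun_eq`). For a central continuous homomorphism
`sc : 𝔸_Kˣ → GL_n(𝔸_K)` sending principal ideles to rational points (the scalar embedding), Haar measures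
`ν_I`, `β`, `α` on `𝔸_Kˣ`, `𝕀_K¹`, `ρ(ℝ_{>0})` with `ν_I ↦ κ₁ (β ⊗ α)` along the splitting, an
isomorphism `ρ(ℝ_{>0}) ≃ A_G` compatible with `sc` with `ρ_H ↦ κ (α_A ⊗ count)` along `H ≅ A_G × GL_n(K)`, a
`Kˣ`-covering weight `β¹` on `𝕀_K¹`, an idele class domain `𝓕`, a unitary Hecke character `η` trivial on
`A_G`, a Borel `GL_n(K)`-invariant `W : GL_n(𝔸_K) → ℂ`, a `GL_n(K)`-covering weight `βA`, and `g` with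
`∫_𝓕 |W(sc(a) g⁻¹)| dν_I < ∞`: the fibre function `h ↦ f_η(g h)` of

  `f_η(y) = (∫_{𝕀¹} W(sc(b) y⁻¹) η(b) β¹(b) dβ) βA(y⁻¹)`

is `ρ_H`-integrable and

  `∫_H f_η(g h) dρ_H(h) = κ κ₁⁻¹ ∫_𝓕 W(sc(a) g⁻¹) η(a) dν_I(a)`

— the sum over `GL_n(K)` collapses `βA`, the integrals over `A_G` and `𝕀_K¹` recombine into `𝔸_Kˣ`
(`η` being trivial on `A_G`), and the sum over `Kˣ` folds `𝔸_Kˣ` onto `𝓕` collapsing `β¹` (`η` being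
trivial on `Kˣ`). [cite: JacquetShalikaAJM1981, §4] [cite: CogdellAnalyticTheory2004, §2.3] -/
theorem integral_quotientSubgroup_testFunTwisted_eq
    (νI : Measure (ideleGroup K)) [νI.IsHaarMeasure]
    (β : Measure ↥(normOneIdeles K)) [β.IsHaarMeasure]
    (α : Measure ↥(posRealIdeles K)) [α.IsHaarMeasure] [α.IsInvInvariant]
    (sc : ideleGroup K →* (AdelicGroupData.gl n K).Adelic) (hsc_cont : Continuous sc)
    (hsc_comm : ∀ (a : ideleGroup K) (g : (AdelicGroupData.gl n K).Adelic), sc a * g = g * sc a)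
    (hscK : ∀ k : ideleGroup K, k ∈ principalIdeles K → ∃ γ : GL (Fin n) K, (AdelicGroupData.gl n K).toAdelic γ = sc k)
    (ec : ↥(posRealIdeles K) ≃ₜ* ↥(AdelicGroupData.gl n K).center')
    (hec : ∀ p : ↥(posRealIdeles K),
      ((ec p : ↥(AdelicGroupData.gl n K).center') : (AdelicGroupData.gl n K).Adelic) = sc (p : ideleGroup K))
    {κ κ₁ : ℝ≥0} (hκ₁ : 0 < κ₁)
    (hsplit : Measure.map (ideleSplitEquiv K) νI = κ₁ • β.prod α)
    (hfib : (quotientSubgroupHaar n K).map (quotientSubgroupEquiv n K) =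
      κ • (Measure.map ec α).prod (count : Measure (AdelicGroupData.gl n K).arithmeticSubgroup))
    {β₁ : ↥(normOneIdeles K) → ℝ≥0∞} (hβ₁ : IsCoveringWeight ↥((principalIdeles K).subgroupOf (normOneIdeles K)) β₁)
    {𝓕 : Set (ideleGroup K)} (h𝓕 : IsIdeleClassDomain K 𝓕)
    {η : HeckeCharacter K} (hηu : η.IsUnitary) (hη₀ : ∀ t : ℝ≥0ˣ, η (posRealIdele K t) = 1)
    {W : (AdelicGroupData.gl n K).Adelic → ℂ} (hW : Measurable W)
    (hWK : ∀ (γ : GL (Fin n) K) (y : (AdelicGroupData.gl n K).Adelic), W ((AdelicGroupData.gl n K).toAdelic γ * y) = W y)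
    {βA : (AdelicGroupData.gl n K).Adelic → ℝ≥0∞} (hβA : IsCoveringWeight ↥(AdelicGroupData.gl n K).arithmeticSubgroup βA)
    (g : (AdelicGroupData.gl n K).Adelic)
    (hE : ∫⁻ a in 𝓕, ‖W (sc a * g⁻¹)‖ₑ ∂νI < ⊤) :
    Integrable (fun h : ↥(AdelicGroupData.gl n K).quotientSubgroup =>
        (∫ b, W (sc (b : ideleGroup K) * (g * (h : (AdelicGroupData.gl n K).Adelic))⁻¹) * ((η (b : ideleGroup K) : ℂˣ) : ℂ) *
            (wt β₁ b : ℂ) ∂β) * (wt βA (g * (h : (AdelicGroupData.gl n K).Adelic))⁻¹ : ℂ)) (quotientSubgroupHaar n K) ∧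
      ∫ h : ↥(AdelicGroupData.gl n K).quotientSubgroup,
          (∫ b, W (sc (b : ideleGroup K) * (g * (h : (AdelicGroupData.gl n K).Adelic))⁻¹) * ((η (b : ideleGroup K) : ℂˣ) : ℂ) *
              (wt β₁ b : ℂ) ∂β) * (wt βA (g * (h : (AdelicGroupData.gl n K).Adelic))⁻¹ : ℂ) ∂quotientSubgroupHaar n K =
        ((κ : ℝ) : ℂ) * (((κ₁ : ℝ) : ℂ))⁻¹ * ∫ a in 𝓕, W (sc a * g⁻¹) * ((η a : ℂˣ) : ℂ) ∂νI := by
  classical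
  haveI := secondCountableTopology_ideleGroup K
  haveI := t2Space_ideleGroup K
  haveI := locallyCompactSpace_ideleGroup K
  haveI : MeasurableMul (ideleGroup K) := inferInstance
  haveI := locallyCompactSpace_normOneIdeles K
  haveI := locallyCompactSpace_posRealIdeles K
  haveI : BorelSpace ↥(normOneIdeles K) := Subtype.borelSpace _
  haveI : BorelSpace ↥(posRealIdeles K) := Subtype.borelSpace _
  haveI : SecondCountableTopology ↥(normOneIdeles K) := TopologicalSpace.Subtype.secondCountableTopology _
  haveI : SecondCountableTopology ↥(posRealIdeles K) := TopologicalSpace.Subtype.secondCountableTopology _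
  haveI : SFinite β := inferInstance
  haveI : SFinite α := inferInstance
  haveI : BorelSpace ↥(AdelicGroupData.gl n K).center' := Subtype.borelSpace _
  haveI : (Measure.map ec α).IsHaarMeasure :=
    ec.toMulEquiv.isHaarMeasure_map α ec.continuous ec.symm.continuous
  have hκ₁0 : (κ₁ : ℝ≥0∞) ≠ 0 := by exact_mod_cast hκ₁.ne'
  have hηc : Continuous fun x : ideleGroup K => ((η x : ℂˣ) : ℂ) := Units.continuous_val.comp (map_continuous η)
  have hη1 : ∀ x : ideleGroup K, ‖((η x : ℂˣ) : ℂ)‖ₑ ≤ 1 := fun x => by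
    rw [enorm_eq_nnnorm, ← ENNReal.coe_one, ENNReal.coe_le_coe, ← NNReal.coe_le_coe, coe_nnnorm]
    exact (hηu x).le
  ----------------------------------------------------------------
  -- the `[0, ∞]` schemata and the untwisted fibre identity for `|W|`
  ----------------------------------------------------------------
  have hsplitL : ∀ G : ideleGroup K → ℝ≥0∞, Measurable G →
      ∫⁻ x, G x ∂νI = κ₁ * ∫⁻ t, ∫⁻ b, G ((b : ideleGroup K) * (t : ideleGroup K)) ∂β ∂α :=
    fun G hG => lintegral_ideleGroup_eq_of_map_eq hsplit hG
  have hfibL : ∀ Fh : ↥(AdelicGroupData.gl n K).quotientSubgroup → ℝ≥0∞, Measurable Fh →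
      ∫⁻ h, Fh h ∂quotientSubgroupHaar n K = κ * ∫⁻ a, ∑' γ : ↥(AdelicGroupData.gl n K).arithmeticSubgroup,
        Fh ((quotientSubgroupEquiv n K).symm (a, γ)) ∂(Measure.map ec α) :=
    fun Fh hFh => lintegral_quotientSubgroup_eq_mul_lintegral_tsum hfib hFh
  set Wn : (AdelicGroupData.gl n K).Adelic → ℝ≥0∞ := fun y => ‖W y‖ₑ with hWn
  have hWn_meas : Measurable Wn := hW.enorm
  have hWnK : ∀ (γ : GL (Fin n) K) (y : (AdelicGroupData.gl n K).Adelic),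
      Wn ((AdelicGroupData.gl n K).toAdelic γ * y) = Wn y := fun γ y => by simp only [hWn, hWK]
  have huntw := lintegral_quotientSubgroup_testFun_eq νI β α sc hsc_cont hsc_comm hscK ec hec (κ := κ) hκ₁0
    hsplitL hfibL hβ₁ h𝓕 hWn_meas hWnK hβA.measurable hβA.coveringSum_eq g
  -- the majorant fibre integral is finite
  have hfinA : ∫⁻ h : ↥(AdelicGroupData.gl n K).quotientSubgroup,
      (∫⁻ b, Wn (sc (b : ideleGroup K) * (g * (h : (AdelicGroupData.gl n K).Adelic))⁻¹) * β₁ b ∂β) *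
        βA (g * (h : (AdelicGroupData.gl n K).Adelic))⁻¹ ∂quotientSubgroupHaar n K < ⊤ := by
    rw [huntw]
    exact ENNReal.mul_lt_top (ENNReal.mul_lt_top ENNReal.coe_lt_top (ENNReal.inv_lt_top.2 (pos_iff_ne_zero.2 hκ₁0))) hE
  ----------------------------------------------------------------
  -- the twisted test function, its measurability and its domination
  ----------------------------------------------------------------
  set eav : (AdelicGroupData.gl n K).Adelic → ℂ := fun y =>
    ∫ b, W (sc (b : ideleGroup K) * y) * ((η (b : ideleGroup K) : ℂˣ) : ℂ) * (wt β₁ b : ℂ) ∂β with heav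
  set eavA : (AdelicGroupData.gl n K).Adelic → ℝ≥0∞ := fun y => ∫⁻ b, Wn (sc (b : ideleGroup K) * y) * β₁ b ∂β with heavA
  have hwt₁ : Measurable fun b : ↥(normOneIdeles K) => (wt β₁ b : ℂ) :=
    Complex.measurable_ofReal.comp hβ₁.measurable.ennreal_toReal
  have hwtA : Measurable fun y : (AdelicGroupData.gl n K).Adelic => (wt βA y : ℂ) :=
    Complex.measurable_ofReal.comp hβA.measurable.ennreal_toReal
  have hWb_meas : Measurable fun q : (AdelicGroupData.gl n K).Adelic × ↥(normOneIdeles K) =>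
      W (sc (q.2 : ideleGroup K) * q.1) * ((η (q.2 : ideleGroup K) : ℂˣ) : ℂ) * (wt β₁ q.2 : ℂ) := by
    refine Measurable.mul (Measurable.mul (hW.comp ?_) ?_) (hwt₁.comp measurable_snd)
    · exact ((hsc_cont.comp (continuous_subtype_val.comp continuous_snd)).mul continuous_fst).measurable
    · exact (hηc.comp (continuous_subtype_val.comp continuous_snd)).measurable
  have heav_meas : Measurable eav := (hWb_meas.stronglyMeasurable.integral_prod_right').measurable
  have hWnb_meas : Measurable fun q : (AdelicGroupData.gl n K).Adelic × ↥(normOneIdeles K) =>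
      Wn (sc (q.2 : ideleGroup K) * q.1) * β₁ q.2 := by
    refine Measurable.mul (hWn_meas.comp ?_) (hβ₁.measurable.comp measurable_snd)
    exact ((hsc_cont.comp (continuous_subtype_val.comp continuous_snd)).mul continuous_fst).measurable
  have heavA_meas : Measurable eavA := hWnb_meas.lintegral_prod_right'
  have heavK : ∀ (γ : GL (Fin n) K) (y : (AdelicGroupData.gl n K).Adelic),
      eav ((AdelicGroupData.gl n K).toAdelic γ * y) = eav y := by
    intro γ y
    simp only [heav]
    refine integral_congr_ae (ae_of_all _ fun b => ?_)
    dsimp only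
    rw [← mul_assoc (sc (b : ideleGroup K)) ((AdelicGroupData.gl n K).toAdelic γ) y, hsc_comm,
      mul_assoc ((AdelicGroupData.gl n K).toAdelic γ), hWK]
  have heav_le : ∀ y, ‖eav y‖ₑ ≤ eavA y := by
    intro y
    refine (enorm_integral_le_lintegral_enorm _).trans (lintegral_mono fun b => ?_)
    simp only [enorm_mul, hWn]
    calc ‖W (sc (b : ideleGroup K) * y)‖ₑ * ‖((η (b : ideleGroup K) : ℂˣ) : ℂ)‖ₑ * ‖(wt β₁ b : ℂ)‖ₑ
        ≤ ‖W (sc (b : ideleGroup K) * y)‖ₑ * 1 * β₁ b := by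
          gcongr
          · exact hη1 _
          · exact enorm_ofReal_wt_le β₁ b
      _ = _ := by rw [mul_one]
  set f : (AdelicGroupData.gl n K).Adelic → ℂ := fun y => eav y⁻¹ * (wt βA y⁻¹ : ℂ) with hf
  have hf_meas : Measurable f :=
    (heav_meas.comp continuous_inv.measurable).mul (hwtA.comp continuous_inv.measurable)
  have hf_le : ∀ y, ‖f y‖ₑ ≤ eavA y⁻¹ * βA y⁻¹ := fun y => by
    simp only [hf, enorm_mul]
    exact mul_le_mul' (heav_le _) (enorm_ofReal_wt_le βA _)
  -- integrability of the fibre function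
  have hFh : Measurable fun h : ↥(AdelicGroupData.gl n K).quotientSubgroup => f (g * (h : (AdelicGroupData.gl n K).Adelic)) :=
    hf_meas.comp (measurable_const.mul measurable_subtype_coe)
  have hint : Integrable (fun h : ↥(AdelicGroupData.gl n K).quotientSubgroup =>
      f (g * (h : (AdelicGroupData.gl n K).Adelic))) (quotientSubgroupHaar n K) := by
    refine ⟨hFh.aestronglyMeasurable, ?_⟩
    rw [HasFiniteIntegral]
    refine lt_of_le_of_lt (lintegral_mono fun h => hf_le _) ?_
    exact hfinA
  refine ⟨hint, ?_⟩
  change ∫ h : ↥(AdelicGroupData.gl n K).quotientSubgroup, f (g * (h : (AdelicGroupData.gl n K).Adelic))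
    ∂quotientSubgroupHaar n K = _
  ----------------------------------------------------------------
  -- (a) the product structure of `ρ_H`
  ----------------------------------------------------------------
  obtain ⟨-, hintA, hI⟩ := integral_quotientSubgroup_eq_smul_integral_tsum hfib hint
  rw [hI]
  ----------------------------------------------------------------
  -- (b) the sum over `GL_n(K)` collapses the covering weight
  ----------------------------------------------------------------
  have hsum : ∀ a : ↥(AdelicGroupData.gl n K).center',
      ∑' γ : ↥(AdelicGroupData.gl n K).arithmeticSubgroup,
        f (g * (((quotientSubgroupEquiv n K).symm (a, γ) : ↥(AdelicGroupData.gl n K).quotientSubgroup) :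
            (AdelicGroupData.gl n K).Adelic)) =
        eav ((a : (AdelicGroupData.gl n K).Adelic)⁻¹ * g⁻¹) := by
    intro a
    have e1 : ∀ γ : ↥(AdelicGroupData.gl n K).arithmeticSubgroup,
        f (g * (((quotientSubgroupEquiv n K).symm (a, γ) : ↥(AdelicGroupData.gl n K).quotientSubgroup) :
            (AdelicGroupData.gl n K).Adelic)) =
          eav ((a : (AdelicGroupData.gl n K).Adelic)⁻¹ * g⁻¹) *
            ((βA ((γ : (AdelicGroupData.gl n K).Adelic)⁻¹ * ((a : (AdelicGroupData.gl n K).Adelic)⁻¹ * g⁻¹))).toReal : ℂ) := by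
      intro γ
      obtain ⟨γ₀, hγ₀⟩ := γ.2
      have hγinv : ((γ : (AdelicGroupData.gl n K).Adelic))⁻¹ = (AdelicGroupData.gl n K).toAdelic γ₀⁻¹ := by
        rw [map_inv, hγ₀]
      rw [coe_quotientSubgroupEquiv_symm_apply]
      simp only [hf, mul_inv_rev, wt]
      rw [mul_assoc ((γ : (AdelicGroupData.gl n K).Adelic))⁻¹]
      congr 1
      rw [hγinv, heavK]
    simp_rw [e1]
    rw [tsum_mul_left]
    have e2 : ∑' γ : ↥(AdelicGroupData.gl n K).arithmeticSubgroup,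
        ((βA ((γ : (AdelicGroupData.gl n K).Adelic)⁻¹ * ((a : (AdelicGroupData.gl n K).Adelic)⁻¹ * g⁻¹))).toReal : ℂ) = 1 := by
      rw [← Complex.ofReal_tsum, (tsum_coveringWeight_inv_mul hβA _).2, Complex.ofReal_one]
    rw [e2, mul_one]
  simp_rw [hsum]
  have hintA' : Integrable (fun a : ↥(AdelicGroupData.gl n K).center' =>
      eav ((a : (AdelicGroupData.gl n K).Adelic)⁻¹ * g⁻¹)) (Measure.map ec α) :=
    hintA.congr (ae_of_all _ fun a => hsum a)
  ----------------------------------------------------------------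
  -- (c) `∫_{A_G} dα_A = ∫_{ρ(ℝ>0)} dα`, inversion on `ρ(ℝ>0)`, and `sc(p)⁻¹ = sc(p⁻¹)`
  ----------------------------------------------------------------
  set ecm : ↥(posRealIdeles K) ≃ᵐ ↥(AdelicGroupData.gl n K).center' := ec.toHomeomorph.toMeasurableEquiv with hecm
  have hecm' : (ecm : _ → _) = ec := rfl
  have e3 : ∫ a, eav ((a : (AdelicGroupData.gl n K).Adelic)⁻¹ * g⁻¹) ∂(Measure.map ec α) =
      ∫ p, eav (sc (p : ideleGroup K) * g⁻¹) ∂α := by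
    rw [← hecm', integral_map_equiv ecm,
      ← integral_inv_eq_self (fun p : ↥(posRealIdeles K) => eav (sc (p : ideleGroup K) * g⁻¹)) α]
    refine integral_congr_ae (ae_of_all _ fun p => ?_)
    dsimp only
    rw [hecm', hec p, Subgroup.coe_inv, map_inv]
  rw [e3]
  ----------------------------------------------------------------
  -- (d) unfold the average, recombine `ρ(ℝ>0) × 𝕀_K¹` into `𝕀_K`, then fold `𝕀_K` onto `𝓕` by `Kˣ`
  ----------------------------------------------------------------
  set b₀ : ideleGroup K → ↥(normOneIdeles K) := fun x => ⟨normOneRetraction K x, normOneRetraction_mem K x⟩ with hb₀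
  have hb₀c : Continuous b₀ := (continuous_normOneRetraction K).subtype_mk _
  set Gx : ideleGroup K → ℂ := fun x => W (sc x * g⁻¹) * ((η x : ℂˣ) : ℂ) * (wt β₁ (b₀ x) : ℂ) with hGx
  have hGx_meas : Measurable Gx := by
    refine Measurable.mul (Measurable.mul (hW.comp (hsc_cont.mul continuous_const).measurable) hηc.measurable)
      (hwt₁.comp hb₀c.measurable)
  set GxA : ideleGroup K → ℝ≥0∞ := fun x => Wn (sc x * g⁻¹) * β₁ (b₀ x) with hGxA
  have hGxA_meas : Measurable GxA :=
    Measurable.mul (hWn_meas.comp (hsc_cont.mul continuous_const).measurable) (hβ₁.measurable.comp hb₀c.measurable)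
  have hGx_le : ∀ x, ‖Gx x‖ₑ ≤ GxA x := by
    intro x
    simp only [hGx, hGxA, enorm_mul, hWn]
    calc ‖W (sc x * g⁻¹)‖ₑ * ‖((η x : ℂˣ) : ℂ)‖ₑ * ‖(wt β₁ (b₀ x) : ℂ)‖ₑ
        ≤ ‖W (sc x * g⁻¹)‖ₑ * 1 * β₁ (b₀ x) := by
          gcongr
          · exact hη1 _
          · exact enorm_ofReal_wt_le β₁ _
      _ = _ := by rw [mul_one]
  -- the `Kˣ`-unfolding of `∫ GxA dν_I` and of `∫ Gx dν_I`
  set ι₁ : ↥(principalIdeles K) → ↥((principalIdeles K).subgroupOf (normOneIdeles K)) := fun k =>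
    ⟨⟨(k : ideleGroup K), principalIdeles_le_normOneIdeles K k.2⟩, Subgroup.mem_subgroupOf.2 k.2⟩ with hι₁
  have hb₀k : ∀ (x : ideleGroup K) (k : ↥(principalIdeles K)), b₀ ((k : ideleGroup K) * x) = ι₁ k • b₀ x := by
    intro x k
    refine Subtype.ext ?_
    change normOneRetraction K ((k : ideleGroup K) * x) = (k : ideleGroup K) * normOneRetraction K x
    rw [map_mul, normOneRetraction_eq_self K (ideleNorm_principal k.2)]
  have hWk : ∀ (x : ideleGroup K) (k : ↥(principalIdeles K)), W (sc ((k : ideleGroup K) * x) * g⁻¹) = W (sc x * g⁻¹) := by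
    intro x k
    obtain ⟨γ, hγ⟩ := hscK k k.2
    rw [map_mul, mul_assoc, ← hγ, hWK]
  have e7A : ∀ (x : ideleGroup K) (k : ↥(principalIdeles K)), GxA (k • x) = Wn (sc x * g⁻¹) * β₁ (ι₁ k • b₀ x) := by
    intro x k
    change Wn (sc ((k : ideleGroup K) * x) * g⁻¹) * β₁ (b₀ ((k : ideleGroup K) * x)) = _
    simp only [hWn]
    rw [hWk, hb₀k]
  have e7 : ∀ (x : ideleGroup K) (k : ↥(principalIdeles K)), Gx (k • x) =
      W (sc x * g⁻¹) * ((η x : ℂˣ) : ℂ) * (wt β₁ (ι₁ k • b₀ x) : ℂ) := by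
    intro x k
    change W (sc ((k : ideleGroup K) * x) * g⁻¹) * ((η ((k : ideleGroup K) * x) : ℂˣ) : ℂ) *
      (wt β₁ (b₀ ((k : ideleGroup K) * x)) : ℂ) = _
    rw [hWk, hb₀k, map_mul, η.map_principal k.2, one_mul]
  have e8A : ∀ x : ideleGroup K, ∑' k : ↥(principalIdeles K), β₁ (ι₁ k • b₀ x) = 1 := by
    intro x
    have h := hβ₁.coveringSum_eq (b₀ x)
    rw [coveringSum_apply] at h
    rw [← h]
    exact ((Subgroup.subgroupOfEquivOfLe (principalIdeles_le_normOneIdeles K)).symm.toEquiv).tsum_eq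
      (fun k' : ↥((principalIdeles K).subgroupOf (normOneIdeles K)) => β₁ (k' • b₀ x))
  have e8 : ∀ x : ideleGroup K, ∑' k : ↥(principalIdeles K), (wt β₁ (ι₁ k • b₀ x) : ℂ) = 1 := by
    intro x
    simp only [wt]
    rw [← Complex.ofReal_tsum]
    have h := tsum_toReal_coveringWeight_normOne hβ₁ (b₀ x)
    rw [← ((Subgroup.subgroupOfEquivOfLe (principalIdeles_le_normOneIdeles K)).symm.toEquiv).tsum_eq
      (fun k' : ↥((principalIdeles K).subgroupOf (normOneIdeles K)) => (β₁ (k' • b₀ x)).toReal)] at h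
    rw [show (fun k : ↥(principalIdeles K) => (β₁ (ι₁ k • b₀ x)).toReal) =
      fun k => (β₁ (((Subgroup.subgroupOfEquivOfLe (principalIdeles_le_normOneIdeles K)).symm.toEquiv k) • b₀ x)).toReal
      from rfl, h, Complex.ofReal_one]
  have hfd := h𝓕.isFundamentalDomain νI
  -- `∫ GxA dν_I = ∫_𝓕 |W| < ∞`, whence `Gx ∈ L¹(ν_I)`
  have e6A : ∫⁻ x, GxA x ∂νI = ∫⁻ x in 𝓕, Wn (sc x * g⁻¹) ∂νI := by
    rw [lintegral_eq_setLIntegral_tsum_smul νI hfd hGxA_meas.aemeasurable]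
    refine setLIntegral_congr_fun h𝓕.measurableSet fun x _ => ?_
    simp_rw [e7A x]
    rw [ENNReal.tsum_mul_left, e8A x, mul_one]
  have hGx_int : Integrable Gx νI := by
    refine ⟨hGx_meas.aestronglyMeasurable, ?_⟩
    rw [HasFiniteIntegral]
    calc ∫⁻ x, ‖Gx x‖ₑ ∂νI ≤ ∫⁻ x, GxA x ∂νI := lintegral_mono hGx_le
      _ = ∫⁻ x in 𝓕, Wn (sc x * g⁻¹) ∂νI := e6A
      _ < ⊤ := hE
  -- `∫_p eav(sc p g⁻¹) dα = ∫_p ∫_b Gx(b p) dβ dα = κ₁⁻¹ ∫ Gx dν_I`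
  have e4 : ∫ p, eav (sc (p : ideleGroup K) * g⁻¹) ∂α =
      ∫ p, ∫ b, Gx ((b : ideleGroup K) * (p : ideleGroup K)) ∂β ∂α := by
    refine integral_congr_ae (ae_of_all _ fun p => integral_congr_ae (ae_of_all _ fun b => ?_))
    have hr : normOneRetraction K ((b : ideleGroup K) * (p : ideleGroup K)) = b := by
      rw [map_mul, normOneRetraction_eq_self K (mem_normOneIdeles.1 b.2), normOneRetraction_eq_one_of_mem K p.2,
        mul_one]
    have hb : b₀ ((b : ideleGroup K) * (p : ideleGroup K)) = b := Subtype.ext hr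
    simp only [hGx]
    rw [hb, map_mul, map_mul, heckeCharacter_apply_posRealIdeles hη₀ p, mul_one, mul_assoc (sc (b : ideleGroup K))]
  obtain ⟨-, e5⟩ := integral_ideleGroup_eq_of_map_eq hκ₁ hsplit hGx_int
  have e5' : ∫ p, ∫ b, Gx ((b : ideleGroup K) * (p : ideleGroup K)) ∂β ∂α = ((κ₁ : ℝ) : ℂ)⁻¹ * ∫ x, Gx x ∂νI := by
    rw [e5, Complex.real_smul, ← mul_assoc, inv_mul_cancel₀ (by exact_mod_cast hκ₁.ne'), one_mul]
  -- `∫ Gx dν_I = ∫_𝓕 W η`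
  have e6 : ∫ x, Gx x ∂νI = ∫ x in 𝓕, W (sc x * g⁻¹) * ((η x : ℂˣ) : ℂ) ∂νI := by
    rw [integral_eq_setIntegral_tsum_smul νI hfd hGx_int]
    refine setIntegral_congr_fun h𝓕.measurableSet fun x _ => ?_
    simp_rw [e7 x]
    rw [tsum_mul_left, e8 x, mul_one]
  rw [e4, e5', e6, Complex.real_smul]
  ring

end Fibre

end Literature.NumberTheory.Automorphic
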